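import Literature.AlgebraicGeometry.Resolution.MarkedIdeals
import Literature.AlgebraicGeometry.Resolution.SymbolicPowersRsop
import Literature.AlgebraicGeometry.Resolution.IdealSheafLemmas
import Mathlib.AlgebraicGeometry.Stalk
import Mathlib.RingTheory.LocalProperties.Basic
import Mathlib.RingTheory.Localization.LocalizationLocalization
import Mathlib.RingTheory.Ideal.Colon
import Mathlib.AlgebraicGeometry.Noetherian
import HarnessLib

/-!
# Stalks of ideal sheaves, inverse images, colon ideal sheaves, and BGMW Lemma 3.2.1

Topic: `Literature/AlgebraicGeometry/Resolution`. Lemmas over the vocabulary of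
`MarkedIdeals.lean` (stalks `I_x`, orders `ord_x`, marked ideals, controlled transforms), and
the first lemma of Bierstone–Grigoriev–Milman–Włodarczyk, *Effective Hironaka resolution and its
complexity*, arXiv:1206.3090, §3.2 — **Lemma 3.2.1**: for a smooth centre `C ⊆ supp(𝓘, μ)` of a
blow-up `σ : X' → X` with exceptional divisor `D`, (1) `𝓘 ⊆ 𝓘_C^μ` and (2) `σ^*(𝓘) ⊆ 𝓘_D^μ`
("the notion of controlled transform is well defined") — PROVED for schemes, reading "smooth
centre" as: `C_x` is generated by part of a regular system of parameters of the regular local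
ring `𝒪_{X,x}` at each `x ∈ V(C)` (`IsRsopGeneratedAt`, implied by `HasSNCWith E C`), and
"`C ⊆ supp(𝓘, μ)`" over all scheme points of `V(C)` (as in `IsMultipleBlowup`).

* `stalkIdeal_mul`, `stalkIdeal_pow`, `stalkIdeal_eq_top_of_not_mem_support`;
* `le_of_forall_stalkIdeal_le`, `ext_of_forall_stalkIdeal_eq` — **inclusion/equality of
  quasi-coherent ideal sheaves is checked on stalks** (local property of modules);
* `exists_isLocalizationAtPrime_stalk` — **localizing the stalk `𝒪_{X,x}` at a prime `P` gives
  the stalk at a point `y`** (a generization of `x`), compatibly with the stalks of all ideal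
  sheaves (Stacks 01J7: points of `Spec 𝒪_{X,x}`);
* `ideal_top_comap_ι`, `ideal_comap_of_le` — **the inverse image ideal sheaf on affine opens**:
  `(f⁻¹K 𝒪_X)(V) = K(U) · Γ(X, V)` when `f(V) ⊆ U`; `comap_mul`, `comap_pow` — inverse image
  commutes with products and powers;
* `IsRsopGeneratedAt`, `HasSNCWith.isRsopGeneratedAt`;
* `stalkIdeal_le_pow_of_forall_le_idealOrder`, `le_pow_of_support_subset`,
  `MarkedIdeal.ideal_le_pow` — **Lemma 3.2.1 (1)** (via the generic point of `C`:
  `𝓘_x 𝒪_{X,η} ⊆ P^μ 𝒪_{X,η}` means `𝓘_x ⊆ P^{(μ)} = P^μ`, `SymbolicPowersRsop.lean`);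
* `comap_le_comap_pow_of_le_pow`, `MarkedIdeal.comap_ideal_le_pow` — **Lemma 3.2.1 (2)**.

* `Ideal.map_colon_of_fg` — colon ideals commute with localization for finitely generated
  second argument; `colonSections`, `colon_eq_colonSections`, `ideal_colon` — on a locally
  Noetherian scheme **the colon ideal sheaf `(L : M)` of `MarkedIdeals.lean` has sections
  `(L(W) : M(W))`** on affine opens `W`;
* `pow_mul_colon_eq_of_le`, `pow_mul_controlledTransform_eq`,
  `MarkedIdeal.pow_mul_transform_ideal` — **`𝓘(D)^μ · σᶜ(𝓘, μ) = σ^*(𝓘)`**: over a locally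
  Noetherian `X'`, the controlled transform (defined as the colon `(σ^*𝓘 : 𝓘(D)^μ)`) is the
  quotient of the total transform by the invertible `𝓘(D)^μ`, as printed in BGMW §3.2 — PROVED.

## Sources

* [BGMW 2011] §3.2, Lemma 3.2.1 (p. 6, arXiv numbering). [BierstoneGrigorievMilmanWlodarczyk2011]
* The Stacks Project, Tag 01J7 (points of `Spec 𝒪_{X,x}` = generizations of `x`). [StacksProject]
* H. Matsumura, *Commutative Ring Theory* (1986), Thm. 16.2 — through `SymbolicPowersRsop.lean`.
  [Matsumura1987]
-/

noncomputable section

open CategoryTheory CategoryTheory.Limits AlgebraicGeometry TopologicalSpace IsLocalRing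

namespace Literature.AlgebraicGeometry.Resolution

universe u

/-! ## Stalks of products and powers -/

section Algebra

variable {X : Scheme.{u}}

/-- `(I · J)_x = I_x · J_x`. [folklore] -/
theorem stalkIdeal_mul (I J : X.IdealSheafData) (x : X) :
    stalkIdeal (I * J) x = stalkIdeal I x * stalkIdeal J x := by
  obtain ⟨U, hU, hxU, -⟩ :=
    exists_isAffineOpen_mem_and_subset (X := X) (x := x) (U := ⊤) (Opens.mem_top x)
  rw [stalkIdeal_eq_map_germ _ ⟨U, hU⟩ hxU, stalkIdeal_eq_map_germ _ ⟨U, hU⟩ hxU,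
    stalkIdeal_eq_map_germ _ ⟨U, hU⟩ hxU, Scheme.IdealSheafData.ideal_mul, Pi.mul_apply,
    Ideal.map_mul]

/-- `(Iⁿ)_x = (I_x)ⁿ`. [folklore] -/
theorem stalkIdeal_pow (I : X.IdealSheafData) (n : ℕ) (x : X) :
    stalkIdeal (I ^ n) x = stalkIdeal I x ^ n := by
  obtain ⟨U, hU, hxU, -⟩ :=
    exists_isAffineOpen_mem_and_subset (X := X) (x := x) (U := ⊤) (Opens.mem_top x)
  rw [stalkIdeal_eq_map_germ _ ⟨U, hU⟩ hxU, stalkIdeal_eq_map_germ _ ⟨U, hU⟩ hxU,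
    Scheme.IdealSheafData.ideal_pow, Pi.pow_apply, Ideal.map_pow]

/-- Off the support the stalk is the unit ideal. [folklore] -/
theorem stalkIdeal_eq_top_of_not_mem_support {I : X.IdealSheafData} {x : X} (hx : x ∉ I.support) :
    stalkIdeal I x = ⊤ := by
  by_contra h
  exact hx ((mem_support_iff_stalkIdeal_le I x).mpr (IsLocalRing.le_maximalIdeal h))

/-! ## Ideal sheaves are determined by their stalks -/

/-- **An inclusion of (quasi-coherent) ideal sheaves can be checked on stalks**: if
`I_x ⊆ J_x` for every point `x` then `I ≤ J` (on an affine open `U`, membership in `J(U)` is a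
local property of `Γ(X, U)`-modules, the stalks being the localizations at the primes).
[folklore] -/
theorem le_of_forall_stalkIdeal_le {I J : X.IdealSheafData}
    (h : ∀ x : X, stalkIdeal I x ≤ stalkIdeal J x) : I ≤ J := by
  intro U
  refine Ideal.le_of_localization_maximal fun P hP => ?_
  haveI := hP.isPrime
  -- the point `y ∈ U` of the prime `P ⊆ Γ(X, U)`
  let q : PrimeSpectrum Γ(X, U) := ⟨P, hP.isPrime⟩
  have hy : U.2.fromSpec q ∈ (U : X.Opens) := U.2.range_fromSpec.le ⟨q, rfl⟩
  letI : Algebra Γ(X, U) (X.presheaf.stalk (U.2.fromSpec q)) :=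
    (X.presheaf.germ U (U.2.fromSpec q) hy).hom.toAlgebra
  haveI : IsLocalization.AtPrime (X.presheaf.stalk (U.2.fromSpec q)) P :=
    U.2.isLocalization_stalk' q hy
  -- `𝒪_{X,y}` and `Γ(X, U)_P` are both localizations at `P`
  let e : Localization.AtPrime P ≃ₐ[Γ(X, U)] X.presheaf.stalk (U.2.fromSpec q) :=
    IsLocalization.algEquiv P.primeCompl _ _
  have key := h (U.2.fromSpec q)
  rw [stalkIdeal_eq_map_germ I U hy, stalkIdeal_eq_map_germ J U hy] at key
  have key' := Ideal.map_mono (f := e.symm.toAlgHom.toRingHom) key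
  rw [Ideal.map_map, Ideal.map_map] at key'
  have hcomp : e.symm.toAlgHom.toRingHom.comp (X.presheaf.germ U (U.2.fromSpec q) hy).hom =
      algebraMap Γ(X, U) (Localization.AtPrime P) :=
    RingHom.ext fun a => e.symm.commutes a
  rwa [hcomp] at key'

/-- Equality of ideal sheaves can be checked on stalks. [folklore] -/
theorem ext_of_forall_stalkIdeal_eq {I J : X.IdealSheafData}
    (h : ∀ x : X, stalkIdeal I x = stalkIdeal J x) : I = J :=
  le_antisymm (le_of_forall_stalkIdeal_le fun x => (h x).le)
    (le_of_forall_stalkIdeal_le fun x => (h x).ge)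

/-! ## Generization: the stalk at the point of a prime of `𝒪_{X,x}` -/

/-- **Localizing a stalk at a prime gives the stalk at a generization.** For a prime ideal `P`
of `𝒪_{X,x}` there is a point `y` of `X` (the image of `P` under `Spec 𝒪_{X,x} → X`) and a ring
map `φ : 𝒪_{X,x} → 𝒪_{X,y}` exhibiting `𝒪_{X,y}` as the localization `(𝒪_{X,x})_P`, compatibly
with the stalks of all ideal sheaves: `I_y = I_x · 𝒪_{X,y}`. (Inside an affine open
`U = Spec A ∋ x`: `𝒪_{X,x} = A_𝔭`, `P = 𝔮 A_𝔭` for a prime `𝔮 ⊆ 𝔭`, and `𝒪_{X,y} = A_𝔮 = (A_𝔭)_P`.)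
[cite: StacksProject, Tag 01J7] -/
theorem exists_isLocalizationAtPrime_stalk (x : X) (P : Ideal (X.presheaf.stalk x))
    [hP : P.IsPrime] :
    ∃ (y : X) (φ : X.presheaf.stalk x →+* X.presheaf.stalk y),
      (letI := φ.toAlgebra; IsLocalization.AtPrime (X.presheaf.stalk y) P) ∧
      ∀ I : X.IdealSheafData, stalkIdeal I y = (stalkIdeal I x).map φ := by
  obtain ⟨U, hU, hxU, -⟩ :=
    exists_isAffineOpen_mem_and_subset (X := X) (x := x) (U := ⊤) (Opens.mem_top x)
  -- `𝒪_{X,x} = A_𝔭`, `A = Γ(X, U)`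
  let A := Γ(X, U)
  let Ox := X.presheaf.stalk x
  letI algx : Algebra A Ox := (X.presheaf.germ U x hxU).hom.toAlgebra
  haveI instx : IsLocalization.AtPrime Ox (hU.primeIdealOf ⟨x, hxU⟩).asIdeal :=
    hU.isLocalization_stalk ⟨x, hxU⟩
  -- the prime `𝔮 = P ∩ A` and its point `y`
  let 𝔮 : Ideal A := P.comap (algebraMap A Ox)
  haveI h𝔮 : 𝔮.IsPrime := Ideal.IsPrime.comap _
  let q : PrimeSpectrum A := ⟨𝔮, h𝔮⟩
  let y : X := hU.fromSpec q
  have hy : y ∈ U := hU.range_fromSpec.le ⟨q, rfl⟩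
  letI algy : Algebra A (X.presheaf.stalk y) := (X.presheaf.germ U y hy).hom.toAlgebra
  haveI insty : IsLocalization.AtPrime (X.presheaf.stalk y) 𝔮 := hU.isLocalization_stalk' q hy
  -- `L = (𝒪_{X,x})_P` is a localization of `A` at `𝔮`
  let L := Localization.AtPrime P
  haveI instL : IsLocalization.AtPrime L 𝔮 :=
    IsLocalization.isLocalization_isLocalization_atPrime_isLocalization
      (hU.primeIdealOf ⟨x, hxU⟩).asIdeal.primeCompl (S := Ox) L P
  -- hence `L ≅ 𝒪_{X,y}` over `A`
  let e : L ≃ₐ[A] X.presheaf.stalk y := IsLocalization.algEquiv 𝔮.primeCompl _ _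
  let φ : Ox →+* X.presheaf.stalk y := e.toAlgHom.toRingHom.comp (algebraMap Ox L)
  refine ⟨y, φ, ?_, ?_⟩
  · letI := φ.toAlgebra
    let e' : L ≃ₐ[Ox] X.presheaf.stalk y :=
      { e with commutes' := fun r => rfl }
    exact IsLocalization.isLocalization_of_algEquiv P.primeCompl e'
  · intro I
    rw [stalkIdeal_eq_map_germ I ⟨U, hU⟩ hy, stalkIdeal_eq_map_germ I ⟨U, hU⟩ hxU, Ideal.map_map]
    congr 1
    change (X.presheaf.germ U y hy).hom =
      (e.toAlgHom.toRingHom.comp (algebraMap Ox L)).comp (algebraMap A Ox)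
    rw [RingHom.comp_assoc, ← IsScalarTower.algebraMap_eq A Ox L]
    exact RingHom.ext fun a => (e.commutes a).symm

end Algebra
/-! ## Inverse image ideal sheaves on affine opens; inverse images of products -/

section Comap

open Scheme.IdealSheafData

variable {X Y : Scheme.{u}} (f : X ⟶ Y) (K : Y.IdealSheafData)

/-- The top ideal of the restriction `K|_U` of an ideal sheaf to an affine open `U` is `K(U)`
(moved along `Γ(U, ⊤) ≅ Γ(X, U)`). [folklore] -/
theorem ideal_top_comap_ι (U : Y.affineOpens) :
    haveI : IsAffine (U : Y.Opens) := U.2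
    (K.comap (U : Y.Opens).ι).ideal ⟨⊤, isAffineOpen_top _⟩ =
      (K.ideal U).map (U : Y.Opens).topIso.inv.hom := by
  haveI : IsAffine (U : Y.Opens) := U.2
  rw [Scheme.IdealSheafData.ideal_comap_of_isOpenImmersion, Scheme.Opens.ι_appIso, Iso.refl_inv,
    ← K.map_ideal' (U := ⟨(U : Y.Opens).ι ''ᵁ ⊤, (isAffineOpen_top _).image_of_isOpenImmersion _⟩)
      (V := U) (eqToIso (U : Y.Opens).ι_image_top.symm).op.inv]
  exact Ideal.comap_id _

/-- **The inverse image ideal sheaf on affine opens**: if `f` maps the affine open `V ⊆ X` into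
the affine open `U ⊆ Y`, then `(f⁻¹K · 𝒪_X)(V) = K(U) · Γ(X, V)` (extension along
`f.appLE U V : Γ(Y, U) → Γ(X, V)`). [folklore] -/
theorem ideal_comap_of_le (U : Y.affineOpens) (V : X.affineOpens)
    (e : (V : X.Opens) ≤ f ⁻¹ᵁ (U : Y.Opens)) :
    (K.comap f).ideal V = (K.ideal U).map (f.appLE U V e).hom := by
  haveI : IsAffine (U : Y.Opens) := U.2
  haveI : IsAffine (V : X.Opens) := V.2
  -- Step 1: restrict to `V → U`
  have h1 : (K.comap f).comap (V : X.Opens).ι =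
      (K.comap (U : Y.Opens).ι).comap (f.resLE U V e) := by
    rw [← comap_comp, ← comap_comp, Scheme.Hom.resLE_comp_ι]
  -- Step 2: between affine schemes the inverse image is the extended top ideal
  have h2 : ((K.comap f).comap (V : X.Opens).ι).ideal ⟨⊤, isAffineOpen_top _⟩ =
      ((K.ideal U).map (U : Y.Opens).topIso.inv.hom).map (f.resLE U V e).appTop.hom := by
    have hJ : K.comap (U : Y.Opens).ι =
        ofIdealTop ((K.comap (U : Y.Opens).ι).ideal ⟨⊤, isAffineOpen_top _⟩) :=
      (Scheme.IdealSheafData.ext_of_isAffine (by rw [ideal_ofIdealTop_top])).symm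
    rw [h1, ← ideal_top_comap_ι, hJ, comap_ofIdealTop_of_isAffine, ideal_ofIdealTop_top,
      ideal_ofIdealTop_top]
  -- Step 3: and the top ideal upstairs is `(K.comap f)(V)`
  have h3 := ideal_top_comap_ι (K.comap f) V
  have h4 : (K.comap f).ideal V = (((K.comap f).ideal V).map (V : X.Opens).topIso.inv.hom).map
      (V : X.Opens).topIso.hom.hom := by
    rw [Ideal.map_map, ← CommRingCat.hom_comp, Iso.inv_hom_id, CommRingCat.hom_id, Ideal.map_id]
  rw [h4, ← h3, h2, Ideal.map_map, Ideal.map_map, ← CommRingCat.hom_comp, ← CommRingCat.hom_comp,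
    Scheme.Hom.appTop, Scheme.Hom.resLE_app_top, Category.assoc, Category.assoc, Iso.inv_hom_id,
    Category.comp_id, Iso.inv_hom_id_assoc]

/-- Affine opens of `X` mapping into affine opens of `Y` cover `X`. [folklore] -/
theorem iSup_affineOpens_le_preimage_eq_top :
    ⨆ p : {p : X.affineOpens × Y.affineOpens // (p.1 : X.Opens) ≤ f ⁻¹ᵁ (p.2 : Y.Opens)},
      (p.1.1 : X.Opens) = ⊤ := by
  refine top_le_iff.mp fun x _ => ?_
  obtain ⟨U, hU, hxU, -⟩ :=
    exists_isAffineOpen_mem_and_subset (X := Y) (x := f x) (U := ⊤) (Opens.mem_top _)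
  obtain ⟨V, hV, hxV, hVU⟩ :=
    exists_isAffineOpen_mem_and_subset (X := X) (x := x) (U := f ⁻¹ᵁ U) hxU
  exact Opens.mem_iSup.mpr ⟨⟨(⟨V, hV⟩, ⟨U, hU⟩), hVU⟩, hxV⟩

/-- **Inverse image commutes with products of ideal sheaves**: `f⁻¹(K·L) 𝒪_X = f⁻¹K 𝒪_X · f⁻¹L 𝒪_X`.
[folklore] -/
theorem comap_mul (L : Y.IdealSheafData) : (K * L).comap f = K.comap f * L.comap f := by
  refine ext_of_iSup_eq_top (fun p : {p : X.affineOpens × Y.affineOpens //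
      (p.1 : X.Opens) ≤ f ⁻¹ᵁ (p.2 : Y.Opens)} => p.1.1)
    (iSup_affineOpens_le_preimage_eq_top f) fun p => ?_
  rw [ideal_comap_of_le f _ p.1.2 p.1.1 p.2, ideal_mul, Pi.mul_apply, Ideal.map_mul, ideal_mul,
    Pi.mul_apply, ideal_comap_of_le f _ p.1.2 p.1.1 p.2, ideal_comap_of_le f _ p.1.2 p.1.1 p.2]

/-- Inverse image commutes with powers of ideal sheaves. [folklore] -/
theorem comap_pow (n : ℕ) : (K ^ n).comap f = K.comap f ^ n := by
  induction n with
  | zero => rw [pow_zero, pow_zero, one_eq_top, one_eq_top, comap_top]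
  | succ n ih => rw [pow_succ, pow_succ, comap_mul, ih]

end Comap
/-! ## BGMW Lemma 3.2.1 (1): `𝓘 ⊆ 𝓘_C^μ` for an admissible centre `C ⊆ supp(𝓘, μ)` -/

section Lemma321

variable {X : Scheme.{u}}

/-- The local condition on a centre at a point of it (part of `HasSNCWith E C`): `𝒪_{X,x}` is a
regular local ring and `C_x` is generated by part of a regular system of parameters (so that
`V(C)` is regular at `x` and `C_x` is prime). [cite: BierstoneGrigorievMilmanWlodarczyk2011, Def. 3.1.3 (2)] -/
def IsRsopGeneratedAt (C : X.IdealSheafData) (x : X) : Prop :=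
  IsRegularLocalRing (X.presheaf.stalk x) ∧
    ∃ u : Fin (maximalIdeal (X.presheaf.stalk x)).spanFinrank → X.presheaf.stalk x,
      Ideal.span (Set.range u) = maximalIdeal (X.presheaf.stalk x) ∧
      ∃ S : Set (Fin (maximalIdeal (X.presheaf.stalk x)).spanFinrank),
        stalkIdeal C x = Ideal.span (u '' S)

/-- A centre having simple normal crossings with a boundary is rsop-generated at its points.
[folklore] -/
theorem HasSNCWith.isRsopGeneratedAt {E : List X.IdealSheafData} {C : X.IdealSheafData}
    (h : HasSNCWith E C) {x : X} (hx : x ∈ C.support) : IsRsopGeneratedAt C x := by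
  obtain ⟨hreg, u, hu, -, hC⟩ := h x
  exact ⟨hreg, u, hu, hC hx⟩

/-- **BGMW Lemma 3.2.1 (1), stalkwise**: if `C_x = (u_i : i ∈ S)` for a regular system of
parameters `u` of the regular local ring `𝒪_{X,x}` and `ord_y(𝓘) ≥ μ` at every point `y` of
`V(C)`, then `𝓘_x ⊆ C_x^μ`. Proof: at the point `y` of the prime `P = C_x` (`𝒪_{X,y} = (𝒪_{X,x})_P`,
`exists_isLocalizationAtPrime_stalk`) the hypothesis reads `𝓘_x 𝒪_{X,y} ⊆ P^μ 𝒪_{X,y}`, i.e.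
`𝓘_x ⊆ P^{(μ)}`, and `P^{(μ)} = P^μ` (`mem_pow_span_image_rsop_of_mul_mem`). (BGMW argue with
Taylor expansions at closed points; for schemes the generic point of `C` does it.)
[cite: BierstoneGrigorievMilmanWlodarczyk2011, Lemma 3.2.1 (1)] -/
theorem stalkIdeal_le_pow_of_forall_le_idealOrder {I C : X.IdealSheafData} {μ : ℕ} {x : X}
    (hC : IsRsopGeneratedAt C x) (hsupp : ∀ y ∈ C.support, (μ : ℕ∞) ≤ idealOrder I y) :
    stalkIdeal I x ≤ stalkIdeal C x ^ μ := by
  classical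
  obtain ⟨hreg, u, hu, S, hS⟩ := hC
  haveI := hreg
  -- `P := C_x = (u_i : i ∈ T)` for the finset `T = S`, a prime ideal
  set T : Finset (Fin (maximalIdeal (X.presheaf.stalk x)).spanFinrank) := S.toFinite.toFinset
    with hTdef
  have hT : (T : Set _) = S := S.toFinite.coe_toFinset
  have hP' : stalkIdeal C x = Ideal.span (u '' (T : Set _)) := by rw [hT]; exact hS
  haveI hP : (stalkIdeal C x).IsPrime := by rw [hP']; exact isPrime_span_image rfl u hu T
  -- the point `y` of `P`
  obtain ⟨y, φ, hloc, hst⟩ := exists_isLocalizationAtPrime_stalk x (stalkIdeal C x)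
  letI := φ.toAlgebra
  haveI := hloc
  have hφ : algebraMap (X.presheaf.stalk x) (X.presheaf.stalk y) = φ := rfl
  have hCy : stalkIdeal C y = maximalIdeal (X.presheaf.stalk y) := by
    rw [hst C, ← hφ]
    exact IsLocalization.AtPrime.map_eq_maximalIdeal (stalkIdeal C x) (X.presheaf.stalk y)
  have hy : y ∈ C.support := (mem_support_iff_stalkIdeal_le C y).mpr hCy.le
  have hIy : stalkIdeal I y ≤ maximalIdeal (X.presheaf.stalk y) ^ μ :=
    (le_idealOrder_iff I y μ).mp (hsupp y hy)
  intro f hf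
  -- `φ f ∈ P^μ 𝒪_{X,y}`
  have h1 : φ f ∈ (stalkIdeal C x ^ μ).map φ := by
    rw [Ideal.map_pow, ← hst C, hCy]
    exact hIy (by rw [hst I]; exact Ideal.mem_map_of_mem φ hf)
  -- pull back along the localization: `s f - i ↦ 0`, so `t (s f - i) = 0`, `s, t ∉ P`, `i ∈ P^μ`
  obtain ⟨⟨i, s⟩, his⟩ := (IsLocalization.mem_map_algebraMap_iff (stalkIdeal C x).primeCompl
    (X.presheaf.stalk y)).mp h1
  have h2 : algebraMap (X.presheaf.stalk x) (X.presheaf.stalk y) (f * s - i) = 0 := by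
    rw [map_sub, map_mul, hφ]
    exact sub_eq_zero.mpr his
  obtain ⟨t, ht⟩ := (IsLocalization.map_eq_zero_iff (stalkIdeal C x).primeCompl
    (X.presheaf.stalk y) _).mp h2
  have h3 : ((t : X.presheaf.stalk x) * s) * f ∈ stalkIdeal C x ^ μ := by
    have e : ((t : X.presheaf.stalk x) * s) * f = t * i := by
      have := ht
      linear_combination this
    rw [e]
    exact Ideal.mul_mem_left _ _ i.2
  have hts : ((t : X.presheaf.stalk x) * s) ∉ stalkIdeal C x := (t * s).2
  -- forget that `t`, `s` came from the submonoid, then move to the `span` form of `P`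
  obtain ⟨a, ha⟩ : ∃ a : X.presheaf.stalk x, a = (t : X.presheaf.stalk x) * s := ⟨_, rfl⟩
  rw [← ha] at h3 hts
  rw [hP'] at h3 hts ⊢
  exact mem_pow_span_image_rsop_of_mul_mem rfl u hu T hts μ h3

/-- **BGMW Lemma 3.2.1 (1)**: if the centre `C` is rsop-generated at its points (e.g. it has
simple normal crossings with a boundary, `HasSNCWith`) and `V(C) ⊆ supp(𝓘, μ)` then
`𝓘 ⊆ 𝓘_C^μ` ("Let `C ⊂ supp(𝓘, μ)` be a smooth center of a blow-up … Then `𝓘 ⊂ 𝓘_C^μ`").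
[cite: BierstoneGrigorievMilmanWlodarczyk2011, Lemma 3.2.1 (1)] -/
theorem le_pow_of_support_subset {I C : X.IdealSheafData} {μ : ℕ}
    (hC : ∀ x ∈ C.support, IsRsopGeneratedAt C x)
    (hsupp : ∀ y ∈ C.support, (μ : ℕ∞) ≤ idealOrder I y) : I ≤ C ^ μ := by
  refine le_of_forall_stalkIdeal_le fun x => ?_
  rw [stalkIdeal_pow]
  by_cases hx : x ∈ C.support
  · exact stalkIdeal_le_pow_of_forall_le_idealOrder (hC x hx) hsupp
  · rw [stalkIdeal_eq_top_of_not_mem_support hx, Ideal.top_pow]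
    exact le_top

/-- **BGMW Lemma 3.2.1 (1) for marked ideals**: for an admissible centre of a marked ideal
`(X, 𝓘, E, μ)` — `V(C) ⊆ supp(𝓘, μ)` with simple normal crossings with `E` — one has
`𝓘 ⊆ 𝓘_C^μ`. [cite: BierstoneGrigorievMilmanWlodarczyk2011, Lemma 3.2.1 (1)] -/
theorem MarkedIdeal.ideal_le_pow (M : MarkedIdeal X) {C : X.IdealSheafData}
    (hsupp : (C.support : Set X) ⊆ M.support) (hsnc : HasSNCWith M.boundary C) :
    M.ideal ≤ C ^ M.mult :=
  le_pow_of_support_subset (fun _ hx => hsnc.isRsopGeneratedAt hx) fun _ hy => hsupp hy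

end Lemma321

/-! ## BGMW Lemma 3.2.1 (2): `σ^*(𝓘) ⊆ 𝓘_D^μ` -/

section Lemma321b

variable {X X' : Scheme.{u}}

/-- `𝓘 ⊆ 𝓘_C^μ` implies `σ^*(𝓘) ⊆ (σ^*𝓘_C)^μ = 𝓘_D^μ` for any morphism `σ : X' → X`
(`D = σ⁻¹(C)`). [cite: BierstoneGrigorievMilmanWlodarczyk2011, Lemma 3.2.1 (2)] -/
theorem comap_le_comap_pow_of_le_pow {I C : X.IdealSheafData} {μ : ℕ} (h : I ≤ C ^ μ)
    (σ : X' ⟶ X) : I.comap σ ≤ C.comap σ ^ μ := by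
  rw [← comap_pow]
  exact Scheme.IdealSheafData.comap_mono σ h

/-- **BGMW Lemma 3.2.1 (2)**: for an admissible centre `C` of the marked ideal `(X, 𝓘, E, μ)`
and the blow-up `σ : X' → X` along `C` (indeed any morphism) with exceptional divisor
`D = σ⁻¹(C)`, `σ^*(𝓘) ⊆ 𝓘(D)^μ` ("`σ^*(𝓘) ⊂ σ^*(𝓘_C)^μ = (𝓘_D)^μ`"). Consequently the controlled
transform `𝓘' = (σ^*𝓘 : 𝓘(D)^μ)` deserves its name `𝓘(D)^{-μ} σ^*(𝓘)`.
[cite: BierstoneGrigorievMilmanWlodarczyk2011, Lemma 3.2.1 (2)] -/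
theorem MarkedIdeal.comap_ideal_le_pow (M : MarkedIdeal X) {C : X.IdealSheafData}
    (hsupp : (C.support : Set X) ⊆ M.support) (hsnc : HasSNCWith M.boundary C) (σ : X' ⟶ X) :
    M.ideal.comap σ ≤ C.comap σ ^ M.mult :=
  comap_le_comap_pow_of_le_pow (M.ideal_le_pow hsupp hsnc) σ

end Lemma321b

/-! ## Colon ideals and localization; the sections of the colon ideal sheaf -/

section ColonAlgebra

variable {A : Type*} [CommRing A] (Mo : Submonoid A) (S : Type*) [CommRing S] [Algebra A S]

/-- **Colon ideals commute with localization when the second argument is finitely generated**: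
`(L : M) · S = (L S : M S)` for `S = Mo⁻¹ A` and `M` finitely generated. [folklore] -/
theorem Ideal.map_colon_of_fg [IsLocalization Mo S] (L M : Ideal A) (hM : M.FG) :
    (L.colon (M : Set A)).map (algebraMap A S) =
      (L.map (algebraMap A S)).colon (M.map (algebraMap A S) : Set S) := by
  classical
  apply le_antisymm
  · -- `(L : M) S ⊆ (L S : M S)`
    rw [Ideal.map_le_iff_le_comap]
    intro r hr
    rw [Ideal.mem_comap]
    change algebraMap A S r ∈ (L.map (algebraMap A S)).colon
      (Ideal.span (algebraMap A S '' (M : Set A)) : Set S)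
    rw [Ideal.colon_span, Submodule.mem_colon]
    rintro _ ⟨m, hm, rfl⟩
    rw [smul_eq_mul, ← map_mul]
    exact Ideal.mem_map_of_mem _ (Submodule.mem_colon.mp hr m hm)
  · -- `(L S : M S) ⊆ (L : M) S`: clear denominators against a finite generating set of `M`
    intro z hz
    obtain ⟨F, hF⟩ := hM
    obtain ⟨⟨a, s⟩, rfl⟩ := IsLocalization.mk'_surjective Mo z
    dsimp only at hz ⊢
    -- `a/1 ∈ (L S : M S)` as well
    have ha : algebraMap A S a ∈ (L.map (algebraMap A S)).colon (M.map (algebraMap A S) : Set S) := by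
      rw [← IsLocalization.mk'_spec S a s]
      exact Ideal.mul_mem_right _ _ hz
    -- for each generator `m ∈ F`: `c_m a m ∈ L` for some `c_m ∈ Mo`
    have key : ∀ m ∈ F, ∃ c : Mo, (c : A) * (a * m) ∈ L := by
      intro m hm
      have h1 : algebraMap A S a * algebraMap A S m ∈ L.map (algebraMap A S) := by
        refine Submodule.mem_colon.mp ha _ ?_
        exact Ideal.mem_map_of_mem _ (hF ▸ Ideal.subset_span hm)
      rw [← map_mul] at h1
      obtain ⟨⟨ℓ, t⟩, hℓt⟩ := (IsLocalization.mem_map_algebraMap_iff Mo S).mp h1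
      have h2 : algebraMap A S ((a * m) * t - ℓ) = 0 := by
        rw [map_sub, map_mul]
        exact sub_eq_zero.mpr hℓt
      obtain ⟨u, hu⟩ := (IsLocalization.map_eq_zero_iff Mo S _).mp h2
      refine ⟨u * t, ?_⟩
      have e : ((u * t : Mo) : A) * (a * m) = u * ℓ := by
        have := hu
        push_cast
        linear_combination this
      rw [e]
      exact Ideal.mul_mem_left _ _ ℓ.2
    choose! c hc using key
    -- `C := ∏ c_m ∈ Mo` works for all generators at once
    let C : Mo := ∏ m ∈ F, c m
    have hC : ∀ m ∈ F, (C : A) * (a * m) ∈ L := by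
      intro m hm
      have : (C : A) = (∏ m' ∈ F.erase m, (c m' : A)) * c m := by
        change ((∏ m' ∈ F, c m' : Mo) : A) = _
        rw [Submonoid.coe_finsetProd, ← Finset.prod_erase_mul F (fun m' => (c m' : A)) hm]
      rw [this, mul_assoc]
      exact Ideal.mul_mem_left _ _ (hc m hm)
    have hCa : (C : A) * a ∈ L.colon (M : Set A) := by
      rw [← hF, Ideal.colon_span, Submodule.mem_colon]
      intro m hm
      rw [smul_eq_mul, mul_assoc]
      exact hC m hm
    -- hence `a/s = (C a) / (C s) ∈ (L : M) S`
    have : IsLocalization.mk' S a s = IsLocalization.mk' S ((C : A) * a) (C * s) := by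
      rw [IsLocalization.mk'_eq_iff_eq]
      simp only [Submonoid.coe_mul]
      ring_nf
    rw [this, IsLocalization.mk'_eq_mul_mk'_one]
    exact Ideal.mul_mem_right _ _ (Ideal.mem_map_of_mem _ hCa)

end ColonAlgebra

section ColonSheaf

variable {X : Scheme.{u}} [IsLocallyNoetherian X] (L M : X.IdealSheafData)

/-- On a locally Noetherian scheme, the **sectionwise colon** `W ↦ (L(W) : M(W))` is an ideal
sheaf (colon ideals commute with localization for finitely generated `M(W)`,
`Ideal.map_colon_of_fg`). [folklore] -/
def colonSections : X.IdealSheafData where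
  ideal W := (L.ideal W).colon (M.ideal W : Set Γ(X, W))
  map_ideal_basicOpen W f := by
    haveI : IsNoetherianRing Γ(X, W) := IsLocallyNoetherian.component_noetherian W
    haveI := W.2.isLocalization_basicOpen f
    have h := Ideal.map_colon_of_fg (Submonoid.powers f) Γ(X, X.basicOpen f) (L.ideal W)
      (M.ideal W) (IsNoetherian.noetherian _)
    rw [← L.map_ideal_basicOpen, ← M.map_ideal_basicOpen]
    exact h

/-- The sections of `colonSections`. [folklore] -/
@[simp] theorem colonSections_ideal (W : X.affineOpens) :
    (colonSections L M).ideal W = (L.ideal W).colon (M.ideal W : Set Γ(X, W)) := rfl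

/-- **The colon ideal sheaf is the sectionwise colon** (on a locally Noetherian scheme):
`colon L M = colonSections L M`. [folklore] -/
theorem colon_eq_colonSections : colon L M = colonSections L M := by
  apply le_antisymm
  · intro W r hr
    rw [colonSections_ideal, Submodule.mem_colon]
    intro m hm
    have h := mul_colon_le L M W
    rw [Scheme.IdealSheafData.ideal_mul, Pi.mul_apply] at h
    rw [smul_eq_mul, mul_comm]
    exact h (Ideal.mul_mem_mul hm hr)
  · refine le_colon_iff.mpr fun W => ?_
    rw [Scheme.IdealSheafData.ideal_mul, Pi.mul_apply, colonSections_ideal, Ideal.mul_le]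
    intro m hm r hr
    rw [mul_comm]
    exact Submodule.mem_colon.mp hr m hm

/-- **Sections of the colon ideal sheaf**: `(L : M)(W) = (L(W) : M(W))` for affine `W`
(locally Noetherian scheme). [folklore] -/
theorem ideal_colon (W : X.affineOpens) :
    (colon L M).ideal W = (L.ideal W).colon (M.ideal W : Set Γ(X, W)) := by
  rw [colon_eq_colonSections, colonSections_ideal]

end ColonSheaf

/-! ## The controlled transform times `𝓘(D)^μ` is the total transform -/

section Controlled

variable {X X' : Scheme.{u}} [IsLocallyNoetherian X'] (σ : X' ⟶ X) (C : X.IdealSheafData)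

/-- In a commutative ring: if `L ⊆ (b)` then `L ⊆ (b) · (L : b)`. [folklore] -/
theorem Ideal.le_span_singleton_mul_colon {R : Type*} [CommRing R] (L₀ : Ideal R) (b : R)
    (h : L₀ ≤ Ideal.span {b}) : L₀ ≤ Ideal.span {b} * L₀.colon (Ideal.span {b} : Set R) := by
  intro ℓ hℓ
  obtain ⟨q, rfl⟩ := Ideal.mem_span_singleton'.mp (h hℓ)
  rw [mul_comm q b]
  refine Ideal.mul_mem_mul (Ideal.mem_span_singleton_self _) ?_
  rw [Ideal.mem_colon_span_singleton]
  exact hℓ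

/-- If `M` is effective Cartier (locally generated by a nonzerodivisor) and `L ⊆ M^μ`, then
`M^μ · (L : M^μ) = L`. [folklore] -/
theorem pow_mul_colon_eq_of_le {L M : X'.IdealSheafData} (hM : IsEffectiveCartier M) {μ : ℕ}
    (h : L ≤ M ^ μ) : M ^ μ * colon L (M ^ μ) = L := by
  refine le_antisymm (mul_colon_le _ _) ?_
  -- check on the Cartier charts of `M`
  choose U hxU g hg hMU using hM
  have hcov : ⨆ x, (U x : X'.Opens) = ⊤ :=
    top_le_iff.mp fun x _ => Opens.mem_iSup.mpr ⟨x, hxU x⟩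
  refine Scheme.IdealSheafData.le_of_iSup_eq_top U hcov fun x => ?_
  have hMU' : (M ^ μ).ideal (U x) = Ideal.span {g x ^ μ} := by
    rw [Scheme.IdealSheafData.ideal_pow, Pi.pow_apply, hMU, Ideal.span_singleton_pow]
  rw [Scheme.IdealSheafData.ideal_mul, Pi.mul_apply, ideal_colon, hMU']
  exact Ideal.le_span_singleton_mul_colon _ _ (hMU' ▸ h (U x))

/-- **`𝓘(D)^μ · σᶜ(𝓘, μ) = σ^*(𝓘)`**: the controlled transform is the quotient of the total
transform by `𝓘(D)^μ` as soon as `σ^*(𝓘) ⊆ 𝓘(D)^μ` (BGMW Lemma 3.2.1 (2)) and the exceptional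
ideal `𝓘(D) = σ^*(𝓘_C)` is effective Cartier (e.g. `σ` a blow-up along `C`,
`IsBlowup.isEffectiveCartier`) — over a locally Noetherian `X'`.
[cite: BierstoneGrigorievMilmanWlodarczyk2011, §3.2] -/
theorem pow_mul_controlledTransform_eq {I : X.IdealSheafData} {μ : ℕ}
    (hD : IsEffectiveCartier (C.comap σ)) (h : I.comap σ ≤ C.comap σ ^ μ) :
    C.comap σ ^ μ * controlledTransform σ C I μ = I.comap σ :=
  pow_mul_colon_eq_of_le hD h

/-- For an admissible centre of a marked ideal `M` and a blow-up `σ` along it (locally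
Noetherian `X'`): `𝓘(D)^μ · 𝓘' = σ^*(𝓘)` for the transform `M' = (𝓘', E', μ)`.
[cite: BierstoneGrigorievMilmanWlodarczyk2011, §3.2 with Lemma 3.2.1] -/
theorem MarkedIdeal.pow_mul_transform_ideal (M : MarkedIdeal X) {C : X.IdealSheafData}
    (hsupp : (C.support : Set X) ⊆ M.support) (hsnc : HasSNCWith M.boundary C)
    (hσ : IsBlowup σ C) :
    C.comap σ ^ M.mult * (M.transform σ C).ideal = M.ideal.comap σ :=
  pow_mul_controlledTransform_eq σ C hσ.isEffectiveCartier (M.comap_ideal_le_pow hsupp hsnc σ)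

end Controlled

end Literature.AlgebraicGeometry.Resolution

end
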